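import Summits.Ventures.HSemireg.WedgeHankelRecurrenceResultant
import Summits.Ventures.HSemireg.WedgeHankelRecurrencePowerSums

/-!
# Venture HSemireg — THE DISCRIMINANT AS THE HANKEL DETERMINANT OF THE NEWTON SUMS (Borchardt ∕ Hermite ∕ Sylvester, the printed form of N80): for `m` monic of degree `d = t + 1`,
# **`det (dualSeq m m′ (i + j))_{i,j ≤ t} = disc(m)`** (Mathlib's `Polynomial.discr`), **`N_{K[X]/(m) ∕ K}(m′(x)) = (−1)^{d(d−1)/2} disc(m)`**, and for split `m = ∏_{i ≤ t} (X − λ_i)`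
# **`disc(m) = ∏_{i<j} (λ_j − λ_i)²`**; the sign bookkeeping is `sign(reversal of t + 1 letters) = (−1)^{t(t+1)/2}`.  «`disc(m) = 0 ⟺ m` not separable» (monic `m`) is ALREADY the PROVED
# Literature lemma `Literature.LinearAlgebra.Matrix.discr_eq_zero_iff_not_separable_of_monic` (Basu–Pollack–Roy Prop. 4.3, module `CharpolyDiscTwinBridge`) — not restated and not imported
# here (its module carries an analysis closure); combine it with `det_hankelSq_dualSeq_derivative` for «`det H_t(m′/m) ≠ 0 ⟺ m` separable» (N96 proves that directly from N73)
# («the Hankel determinant of the power sums `p_0, …, p_{2t}` is the discriminant»)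

HONEST FRAMING. Part of the Lean index of the computation cell `pub-hsemireg` (seat p10 gen 31, Sunday typer «UNIFORM-IN-n»).
LINEAR ALGEBRA OF HANKEL (catalecticant) MATRICES and of polynomials over a field ONLY (`Polynomial.resultant`, `Polynomial.discr`, `Equiv.Perm.sign`): no variety, no cohomology theory, no sheaf,
no Ext group and no semiregularity map is constructed here; nothing here says that HC / HC_CM / HC_AV holds; no Literature fact is declared or used (N94's import `NormResultant` is PROVED).
Custodian versions as in `WedgeHankelSiegelIdeal` (1/3).

WHAT IS IN THE TREE ∕ LINEAGE.  N94 (`WedgeHankelRecurrenceResultant`): `det_mulResidueMat_eq_resultant_of_le` (`det M_a = Res(m, a)` at the degrees `(t + 1, n ≥ deg a)`; through the PROVED Literature module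
`Literature.RingTheory.Norm.NormResultant`, Cohen Prop. 4.3.4);
N73: `det_hankelSq_dualSeq` (`det H_t(a/m) = sign(revPerm) · det M_a`), `det_mulResidueMat_eq_norm`, `det_mulResidueMat_ne_zero_iff`; N80 (`WedgeHankelRecurrencePowerSums`): `det_hankelSq_powerSums`
(`det H_t(m′/m) = ∏_{i<j}(λ_j − λ_i)²` for `m = ∏_{i ≤ t} (X − λ_i)`).  Mathlib: `Polynomial.discr` (`= det sylvesterDeriv · (−1)^{d(d−1)/2}`), `resultant_deriv`
(`Res(f, f′)_{(d, d−1)} = (−1)^{d(d−1)/2} · lc(f) · disc(f)`), `Equiv.Perm.sign_eq_prod_prod_Ioi`, `Fin.rev_lt_rev`, `Fin.card_Ioi`, `Finset.sum_range_id`.  The integer identity `sign(Fin.revPerm on Fin n) = (−1)^{n(n−1)/2}` is also typed elsewhere in the tree (`Literature.NumberTheory.LFunctions.XiToeplitzCubicWedge.sign_revPerm`,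
not imported: L-function closure); here only its image in `K` for `n = t + 1` is proved, inline.
THIS FILE (namespace `Summit.Ventures.HSemireg.Wedge.HankelOuter` continued; CHAINED on N94 (PLAIN parent) + TREE N80; 0 definitions):
* §653 `cast_sign_revPerm` (`(sign(reversal of t + 1 letters) : K) = (−1)^{(t+1)t/2}` — every pair is an inversion), **`det_mulResidueMat_derivative`** (`det M_{m′} = (−1)^{(t+1)t/2} disc(m)`, N94 + Mathlib `resultant_deriv`), **`norm_adjoinRoot_mk_derivative`** (`N(m′(x)) = (−1)^{(t+1)t/2} disc(m)`),
  **`det_hankelSq_dualSeq_derivative`** (`det H_t(m′/m) = disc(m)` — the two signs cancel), **`discr_prod_X_sub_C`** (`disc(∏_{i ≤ t} (X − λ_i)) = (∏_i ∏_{j>i} (λ_j − λ_i))²`, via N80).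
Nothing Ext-side.  New names only.
-/

open Module Polynomial
open scoped Matrix Polynomial

namespace Summit.Ventures.HSemireg.Wedge.HankelOuter

open Summit.Ventures.HSemireg.Wedge Summit.Ventures.HSemireg.Wedge.Hankel Summit.Ventures.HSemireg.Wedge.HankelSecant

variable (K : Type*) [Field K]

/-! ## §653. `det H_t(m′/m) = disc(m)` -/

/-- **`sign(reversal of t + 1 letters) = (−1)^{(t+1)t/2}`** read in `K`: every pair `i < j` is an inversion of `Fin.rev`, and there are `Σ_i (t − i) = (t+1)t/2` pairs (the integer form is
`Literature.NumberTheory.LFunctions.XiToeplitzCubicWedge.sign_revPerm`, not imported here). -/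
theorem cast_sign_revPerm (t : ℕ) : (((Equiv.Perm.sign (Fin.revPerm : Equiv.Perm (Fin (t + 1))) : ℤˣ) : ℤ) : K) = (-1) ^ ((t + 1) * t / 2) := by
  have hZ : ((Equiv.Perm.sign (Fin.revPerm : Equiv.Perm (Fin (t + 1))) : ℤˣ) : ℤ) = (-1) ^ ((t + 1) * t / 2) := by
    rw [Equiv.Perm.sign_eq_prod_prod_Ioi, Units.coe_prod]
    calc (∏ i : Fin (t + 1), ((∏ j ∈ Finset.Ioi i, (if (Fin.revPerm : Equiv.Perm (Fin (t + 1))) i < Fin.revPerm j then (1 : ℤˣ) else -1) : ℤˣ) : ℤ))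
        = ∏ i : Fin (t + 1), (-1 : ℤ) ^ (t + 1 - 1 - (i : ℕ)) := Finset.prod_congr rfl fun i _ => by
          rw [Finset.prod_congr rfl fun j hj => if_neg fun h => lt_asymm (Finset.mem_Ioi.mp hj) (by rwa [Fin.revPerm_apply, Fin.revPerm_apply, Fin.rev_lt_rev] at h),
            Finset.prod_const, Fin.card_Ioi, Units.val_pow_eq_pow_val, Units.val_neg, Units.val_one]
      _ = (-1 : ℤ) ^ (∑ i : Fin (t + 1), (t + 1 - 1 - (i : ℕ))) := Finset.prod_pow_eq_pow_sum _ _ _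
      _ = (-1) ^ ((t + 1) * t / 2) := by
          rw [Fin.sum_univ_eq_sum_range (fun i => t + 1 - 1 - i) (t + 1), Finset.sum_range_reflect (fun i => i) (t + 1), Finset.sum_range_id, Nat.add_sub_cancel]
  rw [hZ, Int.cast_pow, Int.cast_neg, Int.cast_one]

/-- **`det M_{m′} = (−1)^{(t+1)t/2} · disc(m)`** for `m` monic of degree `t + 1` (N94 `det M_a = Res(m, a)` + Mathlib's `resultant_deriv`: `Res(m, m′)_{(t+1, t)} = (−1)^{(t+1)t/2} · lc(m) · disc(m)`). -/
theorem det_mulResidueMat_derivative {t : ℕ} {m : K[X]} (hm : m.Monic) (hmd : m.natDegree = t + 1) :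
    (mulResidueMat K t m (derivative m)).det = (-1) ^ ((t + 1) * t / 2) * m.discr := by
  have hdeg : 0 < m.degree := by rw [Polynomial.degree_eq_natDegree hm.ne_zero, hmd]; exact_mod_cast Nat.succ_pos t
  have hd' : (derivative m).natDegree ≤ t := (Polynomial.natDegree_derivative_le m).trans (by rw [hmd, Nat.add_sub_cancel])
  rw [det_mulResidueMat_eq_resultant_of_le K hm hmd hd']
  have h := Polynomial.resultant_deriv hdeg
  rw [hmd, Nat.add_sub_cancel, hm.leadingCoeff, mul_one] at h
  exact h

/-- **`N_{K[X]/(m) ∕ K}(m′ mod m) = (−1)^{(t+1)t/2} · disc(m)`** for `m` monic of degree `t + 1` (the classical norm form of the discriminant). -/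
theorem norm_adjoinRoot_mk_derivative {t : ℕ} {m : K[X]} (hm : m.Monic) (hmd : m.natDegree = t + 1) :
    Algebra.norm K (AdjoinRoot.mk m (derivative m)) = (-1) ^ ((t + 1) * t / 2) * m.discr := by
  rw [← det_mulResidueMat_eq_norm K hm hmd, det_mulResidueMat_derivative K hm hmd]

/-- **BORCHARDT ∕ HERMITE: `det (dualSeq m m′ (i + j))_{i,j ≤ t} = disc(m)`** for `m` monic of degree `t + 1` — the Hankel determinant of the Newton sums class `m′/m` IS Mathlib's discriminant
(`sign(revPerm) · (−1)^{(t+1)t/2} = 1`). Any field. -/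
theorem det_hankelSq_dualSeq_derivative {t : ℕ} {m : K[X]} (hm : m.Monic) (hmd : m.natDegree = t + 1) : (hankelSq K t (dualSeq K m (derivative m))).det = m.discr := by
  rw [det_hankelSq_dualSeq K hm hmd, det_mulResidueMat_derivative K hm hmd, ← mul_assoc, cast_sign_revPerm, ← mul_pow, neg_mul_neg, one_mul, one_pow, one_mul]

/-- **`disc(∏_{i ≤ t} (X − λ_i)) = (∏_i ∏_{j > i} (λ_j − λ_i))²`** (any nodes `λ : Fin (t + 1) → K`, repetitions allowed): N80's Hankel determinant of the power sums is the Vandermonde squared,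
and it is the discriminant by `det_hankelSq_dualSeq_derivative`. -/
theorem discr_prod_X_sub_C {t : ℕ} (lam : Fin (t + 1) → K) : (∏ i, (Polynomial.X - C (lam i))).discr = (∏ i : Fin (t + 1), ∏ j ∈ Finset.Ioi i, (lam j - lam i)) ^ 2 := by
  have hm : (∏ i, (Polynomial.X - C (lam i))).Monic := Polynomial.monic_prod_of_monic _ _ fun i _ => Polynomial.monic_X_sub_C _
  have hmd : (∏ i, (Polynomial.X - C (lam i))).natDegree = t + 1 := by
    rw [Polynomial.natDegree_prod_of_monic _ _ fun i _ => Polynomial.monic_X_sub_C _]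
    simp only [Polynomial.natDegree_X_sub_C, Finset.sum_const, Finset.card_univ, Fintype.card_fin, smul_eq_mul, mul_one]
  rw [← det_hankelSq_dualSeq_derivative K hm hmd, det_hankelSq_powerSums]

end Summit.Ventures.HSemireg.Wedge.HankelOuter
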